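import Summits.CriticalPhenomena.CardyFormulaZ2.Theorems.CardyTensorRGPolyominoToJordanUpperSandwichArcs
import Summits.CriticalPhenomena.CardyFormulaZ2.Theorems.CardyIKTransportRenewalGridHarmlessModuli
import Summits.CriticalPhenomena.CardyFormulaZ2.Theorems.CardyComplexConeSLESixFamiliesGiveCardyModulusContinuity
import Summits.CriticalPhenomena.CardyFormulaZ2.Theorems.CardyPolygonWordsAssembly

/-!
# Stub `stub_upperPolyominoSandwich` of line `registered` (crux `PolyominoToJordan`)

Crux `Summit.CriticalPhenomena.CardyFormulaZ2.Theses.CardyTensorRG.PolyominoToJordan`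
(stmt-CriticalPhenomena-14338, route `CardyTensorRG` of `CardyFormulaZ2`), birth line
(`Cruxes/PolyominoToJordan/Lines/birth.lean`), STUB 2 — **the flip-free upper polyomino sandwich
with modulus control**: for every conformal rectangle `R` with uniformizing datum `(φ, x)` and every
`ε > 0` there is a POLYOMINO conformal rectangle `P` (carrier = interior of a finite union of closed
`δ₀`-cells, marked points on `δ₀ℤ²`) with a uniformizing datum `(ψ, y)` such that
`|crossRatio y - crossRatio x| ≤ ε` and, eventually as `δ → 0⁺`, `bond R δ ≤ bond P δ + ε`.

Proof (all ingredients are theorems of the tree).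
* Square model respecting the corners (`exists_isSquareModel_pt`): `Q = unitSquareQuad.map Φ` has
  the carrier, the arcs and the marked points of `R`, hence the same `bondDomainCrossingProb` and
  the same modulus (`RenewalGridHarmless.crossRatio_eq_of_carrier_eq_of_pt_eq`).
* The wider–shorter perturbations `D n = Φ((-1-sₙ, 1+sₙ) × (-1+sₙ, 1-sₙ))`, `sₙ = 1/(n+4)`, have
  moduli tending to that of `Q` (`RenewalGridHarmless.tendsto_crossRatio_perturbQuad`, Radó); fix
  `n` with `|η(D n) - η(Q)| < ε/2`.
* `stub_upperSandwichOfArcs` (the tree's `exists_upper_sandwich` with approximately matched arcs)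
  gives `ε₁ > 0`: every quad whose loop is `ε₁`-close to that of `D n` and whose arcs are pointwise
  `ε₁`-close to those of `D n` contains the G02 crossing event of `Q` in its own, for small meshes.
* Radó continuity of the modulus at `D n` in `ε`-form (`CollarTouchSandwich.stub_modulusContinuity`,
  shift `c = 0`) gives `ε₀`; uniform continuity of `∂(D n)` gives `τ₀` for `ε₁/2`.
* The lattice-polygon approximant `P` of `D n` (`LatticePolygonApproximation.exists_latticePolygon_close`
  at loop-closeness `min (ε₁/2) ε₀` and mark-closeness `min τ₀ ε₀`) is the polyomino: its marks are
  only CLOSE to the quarter marks, but clamping parameters shows its arcs are pointwise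
  `ε₁/2 + ε₁/2`-close to those of `D n` (`abs_nextMark_sub_nextMark_le`); so `bond R δ = bond Q δ ≤
  bond P δ` for small `δ`, and `|η(P) - η(R)| ≤ |η(P) - η(D n)| + |η(D n) - η(Q)| ≤ ε`.

References: O. Schramm, S. Smirnov, Ann. Probab. 39 (2011), proof of Lemma 5.1; B. Bollobás,
O. Riordan, *Percolation* (2006), Ch. 7 remark p. 195; Ch. Pommerenke (1992) Thm 2.11 (Radó).
-/

noncomputable section

namespace Summit.CriticalPhenomena.CardyFormulaZ2.Cruxes.PolyominoToJordan.Birth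

open Set Metric Filter Topology Complex MeasureTheory
open UpperHalfPlane (upperHalfPlaneSet)
open Literature.Probability.RandomPlanarGeometry Literature.Probability.Percolation
open Literature.Probability.LatticeModels
open Summit.CriticalPhenomena.CardyFormulaZ2.Theorems
open Summit.CriticalPhenomena.CardyFormulaZ2.Theorems.CardyIKTransport.RenewalGridHarmless
  (tendsto_crossRatio_perturbQuad crossRatio_eq_of_carrier_eq_of_pt_eq)
open Summit.CriticalPhenomena.CardyFormulaZ2.Theorems.LatticePolygonApproximation
  (exists_latticePolygon_close abs_nextMark_sub_nextMark_le)
open Summit.CriticalPhenomena.CardyFormulaZ2.Cruxes.SLESixFamiliesGiveCardy.CollarTouchSandwich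
  (stub_modulusContinuity)

/-- **Arcs of close quads with close marks are pointwise close.** If the loop of `P` is uniformly
`ρ`-close to the loop of `D`, the marks are `τ₀`-close, and `τ₀`-close parameters of `∂D` are
`ω`-close, then every point of `P.arc i` is within `ρ + ω` of a point of `D.arc i` (clamp the
parameter to the parameter interval of `D.arc i`). [folklore] -/
theorem exists_mem_arc_dist_le (D P : ConformalRectangle) {ρ τ₀ ω : ℝ}
    (hclose : ∀ s, dist (P.boundary s) (D.boundary s) ≤ ρ)
    (hmk : ∀ i, |P.mark i - D.mark i| ≤ τ₀)
    (hcont : ∀ s t : ℝ, |s - t| ≤ τ₀ → dist (D.boundary s) (D.boundary t) < ω) (i : Fin 4) :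
    ∀ z ∈ P.arc i, ∃ q ∈ D.arc i, dist z q ≤ ρ + ω := by
  rintro z ⟨t, ⟨ht1, ht2⟩, rfl⟩
  have hmn : D.mark i ≤ D.nextMark i := (D.mark_lt_nextMark i).le
  have h1 := abs_le.1 (hmk i)
  have h2 := abs_le.1 (abs_nextMark_sub_nextMark_le D P hmk i)
  -- clamp `t` to the parameter interval of `D.arc i`
  set t' := max (D.mark i) (min t (D.nextMark i)) with ht'
  have ht'mem : t' ∈ Icc (D.mark i) (D.nextMark i) :=
    ⟨le_max_left _ _, max_le hmn (min_le_right _ _)⟩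
  have htt' : |t - t'| ≤ τ₀ := by
    rw [abs_le]
    constructor
    · rcases le_total (D.mark i) (min t (D.nextMark i)) with h | h
      · rw [ht', max_eq_right h]; have := min_le_left t (D.nextMark i); linarith
      · rw [ht', max_eq_left h]; linarith
    · have : min t (D.nextMark i) ≤ t' := le_max_right _ _
      rcases le_total t (D.nextMark i) with h | h
      · rw [min_eq_left h] at this; linarith [(abs_nonneg _).trans (hmk i)]
      · rw [min_eq_right h] at this; linarith
  refine ⟨D.boundary t', mem_image_of_mem _ ht'mem, ?_⟩
  calc dist (P.boundary t) (D.boundary t')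
      ≤ dist (P.boundary t) (D.boundary t) + dist (D.boundary t) (D.boundary t') := dist_triangle _ _ _
    _ ≤ ρ + ω := add_le_add (hclose t) (hcont t t' htt').le

/-- **STUB 2 — upper polyomino sandwich with modulus control** (F-free; the flip-free upper half:
Schramm–Smirnov 2011 Lemma 5.1-type perturbation `D⁺` of a square model in MIXED POSITION above
the quad, Bollobás–Riordan Ch. 7 p. 195 remark; for bond-`ℤ²` with polyomino comparison domains).
For every conformal rectangle `R` with uniformizing datum `(φ, x)` and every `ε > 0` there is a
polyomino conformal rectangle `P` with a uniformizing datum `(ψ, y)` such that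
`|crossRatio y - crossRatio x| ≤ ε` and, eventually as `δ → 0⁺`, `bond R δ ≤ bond P δ + ε`.
See the module docstring for the proof.
[cite: SchrammSmirnov2011, Lemma 5.1 p. 21]
[cite: BollobasRiordan2006, Ch. 7 Claims 19–20 p. 192, remark p. 195] -/
theorem stub_upperPolyominoSandwich :
    ∀ (R : Literature.Probability.RandomPlanarGeometry.ConformalRectangle)
      (φ : Literature.Probability.RandomPlanarGeometry.ConformalEquiv
        UpperHalfPlane.upperHalfPlaneSet R.carrier)
      (x : Fin 4 → ℝ), R.IsUniformizing φ x → ∀ ε : ℝ, 0 < ε →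
      ∃ P : Literature.Probability.RandomPlanarGeometry.ConformalRectangle,
        (∃ δ₀ : ℝ, 0 < δ₀ ∧ (∃ s : Finset (ℤ × ℤ), P.carrier = interior (⋃ p ∈ s,
          {z : ℂ | δ₀ * (p.1 : ℝ) ≤ z.re ∧ z.re ≤ δ₀ * ((p.1 : ℝ) + 1) ∧ δ₀ * (p.2 : ℝ) ≤ z.im ∧
            z.im ≤ δ₀ * ((p.2 : ℝ) + 1)})) ∧
          ∀ i, ∃ m n : ℤ, P.pt i = (δ₀ : ℂ) * ((m : ℂ) + (n : ℂ) * Complex.I)) ∧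
        (∃ (ψ : Literature.Probability.RandomPlanarGeometry.ConformalEquiv
            UpperHalfPlane.upperHalfPlaneSet P.carrier) (y : Fin 4 → ℝ),
          P.IsUniformizing ψ y ∧
            |Literature.Probability.RandomPlanarGeometry.crossRatio y -
              Literature.Probability.RandomPlanarGeometry.crossRatio x| ≤ ε) ∧
        ∀ᶠ δ : ℝ in nhdsWithin 0 (Set.Ioi 0),
          Literature.Probability.Percolation.bondDomainCrossingProb R δ ≤
            Literature.Probability.Percolation.bondDomainCrossingProb P δ + ε := by
  intro R φ x hux ε hε
  -- (1) square model respecting the corners; `Q` has the carrier, arcs and marked points of `R`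
  obtain ⟨Φ, hΦ, hΦpt⟩ := exists_isSquareModel_pt R
  set Q : ConformalRectangle := unitSquareQuad.map Φ with hQ
  have hQcar : Q.carrier = R.carrier := by rw [hQ, MarkedDomain.carrier_map, hΦ.image_carrier]
  have hQpt : ∀ i, Q.pt i = R.pt i := fun i => by rw [hQ, MarkedDomain.pt_map, hΦpt]
  have hQarc : ∀ i, Q.arc i = R.arc i := fun i => by rw [hQ, MarkedDomain.arc_map, hΦ.image_arc]
  have hbond : ∀ δ, bondDomainCrossingProb Q δ = bondDomainCrossingProb R δ := fun δ => by
    show discreteCrossingProb half Q.carrier δ (Q.arc 0) (Q.arc 2) =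
      discreteCrossingProb half R.carrier δ (R.arc 0) (R.arc 2)
    rw [hQcar, hQarc, hQarc]
  obtain ⟨ψQ, yQ, hψQ⟩ := MarkedDomain.exists_isUniformizing_holds Q
  have hηQ : crossRatio yQ = crossRatio x := crossRatio_eq_of_carrier_eq_of_pt_eq hQcar hQpt hux hψQ
  -- (2) the wider–shorter perturbations `D n` and the convergence of their moduli (Radó)
  set s : ℕ → ℝ := fun n => 1 / ((n : ℝ) + 4) with hs
  have hs0 : ∀ n, 0 < s n := fun n => by rw [hs]; positivity
  have hs4 : ∀ n, s n ≤ 1 / 4 := fun n => by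
    rw [hs]
    exact one_div_le_one_div_of_le (by norm_num) (by linarith [(n.cast_nonneg : (0 : ℝ) ≤ n)])
  have hx : ∀ n, -1 - s n < 1 + s n := fun n => by linarith [hs0 n]
  have hy : ∀ n, -1 + s n < 1 - s n := fun n => by linarith [hs4 n]
  have hslim : Tendsto s atTop (𝓝 0) := by
    refine squeeze_zero (fun n => (hs0 n).le) (fun n => ?_) tendsto_one_div_add_atTop_nhds_zero_nat
    rw [hs]
    exact one_div_le_one_div_of_le (by positivity) (by linarith)
  have h₀ : Tendsto (fun n => -1 - s n) atTop (𝓝 (-1)) := by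
    simpa using tendsto_const_nhds.sub hslim
  have h₁ : Tendsto (fun n => 1 + s n) atTop (𝓝 1) := by
    simpa using tendsto_const_nhds.add hslim
  have h₂ : Tendsto (fun n => -1 + s n) atTop (𝓝 (-1)) := by
    simpa using tendsto_const_nhds.add hslim
  have h₃ : Tendsto (fun n => 1 - s n) atTop (𝓝 1) := by
    simpa using tendsto_const_nhds.sub hslim
  choose ψn yn hψn using fun n =>
    MarkedDomain.exists_isUniformizing_holds (perturbQuad Φ (-1 - s n) (1 + s n) (-1 + s n) (1 - s n)
      (hx n) (hy n))
  have hlim := tendsto_crossRatio_perturbQuad Φ (x₀ := fun n => -1 - s n) (x₁ := fun n => 1 + s n)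
    (y₀ := fun n => -1 + s n) (y₁ := fun n => 1 - s n) hx hy h₀ h₁ h₂ h₃ ψn yn hψn ψQ yQ hψQ
  obtain ⟨n, hn⟩ := ((Metric.tendsto_nhds.1 hlim) (ε / 2) (by positivity)).exists
  rw [Real.dist_eq] at hn
  set D : ConformalRectangle := perturbQuad Φ (-1 - s n) (1 + s n) (-1 + s n) (1 - s n) (hx n) (hy n)
    with hD
  -- (3) the upper sandwich tolerance `ε₁` of `D`
  obtain ⟨ε₁, hε₁, hsand⟩ := stub_upperSandwichOfArcs Φ (s n) (s n) (hs0 n) (hs0 n)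
    (by linarith [hs4 n])
  -- (4) Radó continuity of the modulus at `D` (`ε`-form) and uniform continuity of `∂D`
  obtain ⟨ε₀, hε₀, hmod⟩ := stub_modulusContinuity D (ψn n) (yn n) (hψn n) (ε / 2) (by positivity)
  obtain ⟨τ₀, hτ₀, -, hτ₀c⟩ := D.toJordanDomain.exists_forall_dist_boundary_lt (ε := ε₁ / 2)
    (by positivity)
  -- (5) the lattice polygon
  obtain ⟨P, d, hd, hPcell, hPpt, hPmark, hPclose⟩ :=
    exists_latticePolygon_close D (ε := min (ε₁ / 2) ε₀) (τ := min τ₀ ε₀)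
      (lt_min (by positivity) hε₀) (lt_min hτ₀ hε₀)
  refine ⟨P, ⟨d, hd, hPcell, hPpt⟩, ?_, ?_⟩
  · -- modulus control: `η(P) ≈ η(D) ≈ η(Q) = η(R)`
    obtain ⟨ψ, y, hψ⟩ := MarkedDomain.exists_isUniformizing_holds P
    refine ⟨ψ, y, hψ, ?_⟩
    have hPD : |crossRatio y - crossRatio (yn n)| ≤ ε / 2 := by
      refine hmod P 0 (fun u => ?_) (fun i => ?_) ψ y hψ
      · rw [add_zero]; exact (hPclose u).trans (min_le_right _ _)
      · rw [add_zero]; exact (hPmark i).trans (min_le_right _ _)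
    calc |crossRatio y - crossRatio x|
        ≤ |crossRatio y - crossRatio (yn n)| + |crossRatio (yn n) - crossRatio x| := abs_sub_le _ _ _
      _ ≤ ε / 2 + ε / 2 := add_le_add hPD (by rw [← hηQ]; exact hn.le)
      _ = ε := by ring
  · -- comparison: `bond R δ = bond Q δ ≤ bond P δ` for small `δ`
    have hclose' : ∀ u, dist (P.boundary u) (D.boundary u) ≤ ε₁ := fun u =>
      (hPclose u).trans ((min_le_left _ _).trans (by linarith))
    have harcs : ∀ (i : Fin 4), ∀ z ∈ P.arc i, ∃ q ∈ D.arc i, dist z q ≤ ε₁ := by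
      intro i z hz
      obtain ⟨q, hq, hzq⟩ := exists_mem_arc_dist_le D P (ρ := ε₁ / 2) (ω := ε₁ / 2)
        (fun u => (hPclose u).trans (min_le_left _ _)) (fun j => (hPmark j).trans (min_le_left _ _))
        hτ₀c i z hz
      exact ⟨q, hq, hzq.trans (by linarith)⟩
    obtain ⟨δ₁, hδ₁, hincl⟩ := hsand P hclose' harcs
    filter_upwards [Ioo_mem_nhdsGT hδ₁] with δ hδ
    have hle : bondDomainCrossingProb Q δ ≤ bondDomainCrossingProb P δ := by
      rw [bondDomainCrossingProb_eq_measureReal, bondDomainCrossingProb_eq_measureReal]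
      exact measureReal_mono (hincl δ hδ.1 hδ.2)
    rw [← hbond δ]
    linarith

end Summit.CriticalPhenomena.CardyFormulaZ2.Cruxes.PolyominoToJordan.Birth

end
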